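/-
Copyright (c) 2026 the pub-hodgecm-mathlib formalisation cell (harness21).  Prover seat hodgecm-mathlib-K2Liu-p14 (g2), Track B «K2-LIT»,
#184♮ = hLiu418 = `stmt-HodgeConjecture-24832`; socket #42S organ S2 («ARCH SPAN BY K-TYPE PATHS», LEAD F0P6-plan (g14) RULINGS «M-158e»∕«M-158f» + BATCH #7;
DESIGN-S2 `F0/P6/F0P6-plan-g14/DESIGN-S2-ArchSpanByKTypePaths.F0P6-plan-g14.md` 41bd43fff4457fcc §4 row S2-F; K2Liu-p11 (g2) PREP-S2F-Anchors a73a5631a05013f6;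
K2Liu-ref1 (g5) PREP-S2 §4; census K2Liu-p14 (g2) 12:08:57Z «=» LEAD 12:09:53Z).
-/
import Summits.HodgeConjecture.HodgeConjecture.Theorems.K2LiuArchScalarSectionUnique   -- ★ `eq_mul_archScalarSection` (uniqueness of the scalar-type vector, tube frame)
import Summits.HodgeConjecture.HodgeConjecture.Theorems.K2LiuSiegelStabBlocks          -- ★ `eq_fromBlocks_of_stab`, `cayley_mem_unitaryGroup`, `det_denom_I_of_stab`
import HarnessLib

/-!
# Crux `HLiu418`, organ S2, file S2-F (part 1): THE GAUSSIAN ANCHOR IN TUBE LETTERS — a section of `I_w(s, χ_k)` with a SCALAR `K_w`-type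
# `det(A+iB)^{m₁} · det(A−iB)^{m₂}` on `Stab(i1)` IS `f(1) · det(g)^{m₁} · f⁰_{s, m₁−m₂}(g)` (det-twisted uniqueness), hence nowhere zero on `U(J)` when `f(1) ≠ 0`

Cell `hodgecm-mathlib`, crux item hLiu418 = `stmt-HodgeConjecture-24832`; squad K2 ∕ K2Liu; prover K2Liu-p14 (g2).  THEOREMS ONLY (no `def`, no instance, no
notation, no named-fact hypothesis, no `sorry`); lane `--supports stmt-HodgeConjecture-24832 --as helper`.

WHY (DESIGN-S2 §3 (v), anchors (G); BATCH #7 (e) «S2-F states `k_σ` BY VALUE»).  The arch Siegel–Weil section of the Gaussian `Gauss_σ` of `V′_σ ⊗ W` is a `K_w`-EIGENVECTOR: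
by ★ Konno–Konno `weilRepPair_κ_hermitePi_zero` (+ ★ `K2LiuArchSectionPlacePinned`) its `K_w = Stab(i1) ≅ U(2) × U(2)`-type is a SCALAR character
`(a, b) ↦ det(a)^{m₁} det(b)^{m₂}` of the two Cayley components `a = A + iB`, `b = A − iB` of `u = (A B; −B A) ∈ Stab(i1)` (★ `K2LiuSiegelStabBlocks`; the exponents —
hence `k_σ`, `l_σ` — are INPUTS here, delivered in tube letters by S2-B `K2LiuArchFrameBridge` (K2Liu-p11) = the binder (F-K); the parabolic law (F-P) is S2-D's
`archSWImage_le_archDegPS` (K2Liu-p05)).  ★ `K2LiuArchScalarSectionUnique.eq_mul_archScalarSection` identifies sections with the PURE type `j(u,i1)^{−k} = det(b)^{−k}`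
(`m₁ = 0`); THIS FILE removes that restriction by the central det-twist and records the consequences S2-C∕S2-asm consume:
* §1 `det_eq_of_stab` — `det u = det(A+iB)·det(A−iB)` on `Stab(i1)` (similarity with `(1 1; i·1 −i·1)`); `det_mul_conj_det_eq_of_isSiegel` — `det p · conj(det A_p) = det A_p` on `P_Δ ∩ U(J)`;
  `charTwist_zpow` — `(z∕z̄)^{−m₁}·(z̄∕|z|)^k = (z̄∕|z|)^{k+2m₁}`; `det_ne_zero_of_mem_UJ`.
* §2 **`eq_mul_det_zpow_mul_archScalarSection`** — if `f` has the parabolic law of `I_w(s, χ_{−(m₁+m₂)})` (`IsArchSiegelSection`) and the scalar type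
  `f(g u) = det(A_u+iB_u)^{m₁}·det(A_u−iB_u)^{m₂}·f(g)` on `Stab(i1)`, then **`f(g) = f(1)·det(g)^{m₁}·archScalarSection (m₁−m₂) s g`** on `U(J)`; hence
  **`ne_zero_of_apply_one_ne_zero`** (`f(1) ≠ 0 ⇒ f` nowhere zero on `U(J)`) and the converse **`det_zpow_mul_archScalarSection_mul_stab`** ∕ `isArchSiegelSection_det_zpow_mul_archScalarSection`
  (the explicit vector `det(g)^{m₁}·f⁰_{s,m₁−m₂}` HAS that law and that type — the generator of the anchor cell `W_{(l_σ,l_σ)} ⊆ Y_σ` for S2-C).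
* (part 2, appended when S2-D∕S2-B are 📤: `swArch_gauss_eq_mul_archScalarSection`, `swArch_gauss_one_ne_zero`, `k_sigma_eq` BY VALUE per BATCH #7 (e).)
References: [Shimura1997, §16.4 (scalar-type vectors)]; [KonnoKonno2007, Lemma 5.2]; [Folland1989, (4.39)]; [LeeZhu1998, §5 (5.3)].
HONEST LABEL.  Count-neutral helper: `HC_CM` is proved only modulo the 7 printed citations (2 remaining named inputs: hLiu418 = `stmt-HodgeConjecture-24832`,
h413 = `stmt-HodgeConjecture-24833`) until rung 0 closes.
-/

set_option autoImplicit false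
set_option linter.dupNamespace false -- the mandated namespace repeats `HodgeConjecture.HodgeConjecture`

noncomputable section

open Complex Matrix
open scoped ComplexOrder ComplexConjugate

namespace Summit.HodgeConjecture.HodgeConjecture.Cruxes.HLiu418.K2LiuArchGaussianKType

open Literature.NumberTheory.ModularForms.SiegelUpperHalfSpace (num denom moeb num_def denom_def moeb_def)
open Summit.HodgeConjecture.HodgeConjecture.Cruxes.HLiu418.K2LiuHermitianTubeCocycle
open Summit.HodgeConjecture.HodgeConjecture.Cruxes.HLiu418.K2LiuHermitianTubeAction
open Summit.HodgeConjecture.HodgeConjecture.Cruxes.HLiu418.K2LiuArchInducedTubeDefs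
open Summit.HodgeConjecture.HodgeConjecture.Cruxes.HLiu418.K2LiuArchInducedTubeSection
open Summit.HodgeConjecture.HodgeConjecture.Cruxes.HLiu418.K2LiuArchScalarSectionUnique
open Summit.HodgeConjecture.HodgeConjecture.Cruxes.HLiu418.K2LiuSiegelStabBlocks

variable {l : Type*} [Fintype l] [DecidableEq l]

/-! ## §1 Determinants on `Stab(i1)` and on `P_Δ ∩ U(J)`; the character bookkeeping -/

/-- the similarity behind the Cayley components: `(A B; −B A) · (1 1; i −i) = (1 1; i −i) · diag(A + iB, A − iB)`. [cite: Shimura1997, §6.5] -/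
theorem rotation_mul_cayleyMatrix (A B : Matrix l l ℂ) :
    fromBlocks A B (-B) A * fromBlocks (1 : Matrix l l ℂ) 1 (I • (1 : Matrix l l ℂ)) (-(I • (1 : Matrix l l ℂ))) =
      fromBlocks (1 : Matrix l l ℂ) 1 (I • (1 : Matrix l l ℂ)) (-(I • (1 : Matrix l l ℂ))) * fromBlocks (A + I • B) 0 0 (A - I • B) := by
  rw [fromBlocks_multiply, fromBlocks_multiply]
  simp only [Matrix.mul_one, Matrix.one_mul, Matrix.mul_zero, add_zero, zero_add, Matrix.mul_neg, Matrix.mul_smul, Matrix.smul_mul,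
    Matrix.neg_mul, smul_add, smul_sub, smul_smul, I_mul_I, neg_smul, one_smul]
  congr 1 <;> abel

/-- the Cayley matrix `(1 1; i −i)` is invertible: `det = det((−2i)·1) ≠ 0`. [folklore] -/
theorem det_cayleyMatrix_ne_zero :
    (fromBlocks (1 : Matrix l l ℂ) 1 (I • (1 : Matrix l l ℂ)) (-(I • (1 : Matrix l l ℂ)))).det ≠ 0 := by
  rw [Matrix.det_fromBlocks_one₁₁, Matrix.mul_one, show -(I • (1 : Matrix l l ℂ)) - I • 1 = (-(2 * I)) • (1 : Matrix l l ℂ) by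
      rw [neg_smul, two_mul, add_smul, neg_add'],
    Matrix.det_smul, Matrix.det_one, mul_one]
  exact pow_ne_zero _ (neg_ne_zero.2 (mul_ne_zero two_ne_zero I_ne_zero))

/-- **`det u = det(A + iB) · det(A − iB)`** for `u = (A B; −B A) ∈ Stab_{U(J)}(i1)` (`A = u₁₁`, `B = u₁₂`; ★ `eq_fromBlocks_of_stab`). [cite: Shimura1997, §6.5] -/
theorem det_eq_of_stab {u : Matrix (l ⊕ l) (l ⊕ l) ℂ} (hu : uᴴ * Matrix.J l ℂ * u = Matrix.J l ℂ) (hI : moeb u (I • (1 : Matrix l l ℂ)) = I • 1) :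
    u.det = (u.toBlocks₁₁ + I • u.toBlocks₁₂).det * (u.toBlocks₁₁ - I • u.toBlocks₁₂).det := by
  have h := congrArg Matrix.det (rotation_mul_cayleyMatrix u.toBlocks₁₁ u.toBlocks₁₂)
  rw [Matrix.det_mul, Matrix.det_mul, Matrix.det_fromBlocks_zero₂₁, ← eq_fromBlocks_of_stab hu hI, mul_comm] at h
  exact mul_left_cancel₀ det_cayleyMatrix_ne_zero h

/-- `det g ≠ 0` for `g ∈ U(J)`. [folklore] -/
theorem det_ne_zero_of_mem_UJ {g : Matrix (l ⊕ l) (l ⊕ l) ℂ} (hg : gᴴ * Matrix.J l ℂ * g = Matrix.J l ℂ) : g.det ≠ 0 := by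
  intro h0
  have h := congrArg Matrix.det hg
  rw [Matrix.det_mul, Matrix.det_mul, h0, mul_zero] at h
  have hJ : (Matrix.J l ℂ).det ≠ 0 := by
    have := Matrix.isUnit_det_J l ℂ
    exact this.ne_zero
  exact hJ h.symm

/-- **`det p · conj(det A_p) = det A_p`** for `p ∈ P_Δ ∩ U(J)` (`D_p = (A_pᴴ)⁻¹` from the block relations ★ `blocks_rel`). [cite: Shimura1997, §16] -/
theorem det_mul_conj_det_eq_of_isSiegel {p : Matrix (l ⊕ l) (l ⊕ l) ℂ} (hp : pᴴ * Matrix.J l ℂ * p = Matrix.J l ℂ) (hp21 : p.toBlocks₂₁ = 0) :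
    p.det * conj p.toBlocks₁₁.det = p.toBlocks₁₁.det := by
  obtain ⟨-, -, h3, -⟩ := blocks_rel hp
  rw [hp21, conjTranspose_zero, Matrix.zero_mul, sub_zero] at h3
  have hdet : conj p.toBlocks₁₁.det * p.toBlocks₂₂.det = 1 := by
    have := congrArg Matrix.det h3
    rwa [Matrix.det_mul, Matrix.det_conjTranspose, Matrix.det_one, Complex.star_def] at this
  have hp' : p.det = p.toBlocks₁₁.det * p.toBlocks₂₂.det := by
    conv_lhs => rw [← fromBlocks_toBlocks p, hp21, Matrix.det_fromBlocks_zero₂₁]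
  rw [hp', mul_assoc, mul_comm p.toBlocks₂₂.det, hdet, mul_one]

/-- `det A_p ≠ 0` for `p ∈ P_Δ ∩ U(J)`. [folklore] -/
theorem det_toBlocks₁₁_ne_zero_of_isSiegel {p : Matrix (l ⊕ l) (l ⊕ l) ℂ} (hp : pᴴ * Matrix.J l ℂ * p = Matrix.J l ℂ) (hp21 : p.toBlocks₂₁ = 0) :
    p.toBlocks₁₁.det ≠ 0 := by
  intro h0
  have h := det_mul_conj_det_eq_of_isSiegel hp hp21
  have hp' : p.det = p.toBlocks₁₁.det * p.toBlocks₂₂.det := by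
    conv_lhs => rw [← fromBlocks_toBlocks p, hp21, Matrix.det_fromBlocks_zero₂₁]
  rw [hp', h0, zero_mul, zero_mul] at h
  exact det_ne_zero_of_mem_UJ hp (by rw [hp', h0, zero_mul])

/-- **character bookkeeping**: for `z ≠ 0` and `w` with `w · conj z = z` (i.e. `w = z ∕ z̄`): `w^{−m₁} · (z̄∕|z|)^k = (z̄∕|z|)^{k + 2m₁}` (`(z̄∕|z|)² = z̄∕z`). [folklore] -/
theorem charTwist_zpow {z w : ℂ} (hz : z ≠ 0) (hw : w * conj z = z) (m₁ k : ℤ) :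
    w ^ (-m₁) * (conj z / ((‖z‖ : ℝ) : ℂ)) ^ k = (conj z / ((‖z‖ : ℝ) : ℂ)) ^ (k + 2 * m₁) := by
  have hzc : conj z ≠ 0 := (map_ne_zero _).2 hz
  have hn : ((‖z‖ : ℝ) : ℂ) ≠ 0 := Complex.ofReal_ne_zero.2 (norm_ne_zero_iff.2 hz)
  have ha : conj z / ((‖z‖ : ℝ) : ℂ) ≠ 0 := div_ne_zero hzc hn
  have hw' : w = z / conj z := by rw [eq_div_iff hzc, hw]
  have hnn : ((‖z‖ : ℝ) : ℂ) * ((‖z‖ : ℝ) : ℂ) = z * conj z := by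
    rw [Complex.mul_conj, Complex.normSq_eq_norm_sq, Complex.ofReal_pow, sq]
  have hsq : (conj z / ((‖z‖ : ℝ) : ℂ)) ^ (2 : ℤ) = w⁻¹ := by
    rw [hw', inv_div, zpow_two, div_mul_div_comm, hnn, mul_div_mul_right _ _ hzc]
  rw [zpow_add₀ ha, _root_.zpow_mul, hsq, _root_.inv_zpow', mul_comm]

/-! ## §2 Det-twisted uniqueness of the scalar-type vector, and its consequences -/

/-- **THE GAUSSIAN ANCHOR IN TUBE LETTERS (det-twisted uniqueness).**  Let `f` have the parabolic law of `I_w(s, χ_k)`, `χ_k(z) = (z̄∕|z|)^k`, with `k = −(m₁+m₂)`,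
and the SCALAR `K_w`-type `f(g u) = det(A_u + iB_u)^{m₁} · det(A_u − iB_u)^{m₂} · f(g)` for `u ∈ Stab_{U(J)}(i1)` (the two Cayley components ★ `cayley_mem_unitaryGroup`).
Then **`f(g) = f(1) · det(g)^{m₁} · archScalarSection (m₁ − m₂) s g`** for every `g ∈ U(J)`.  (`g ↦ det(g)^{−m₁} f(g)` has the law of `χ_{m₁−m₂}` — `det p = det A_p ∕ conj det A_p`
on `P_Δ`, `charTwist_zpow` — and the pure type `j(u,i1)^{−(m₁−m₂)}` — `det u = det(A+iB) det(A−iB)`, `j(u,i1) = det(A−iB)` ★ — so ★ `eq_mul_archScalarSection` applies.)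
[cite: Shimura1997, §16.4] [cite: KonnoKonno2007, Lemma 5.2] -/
theorem eq_mul_det_zpow_mul_archScalarSection (m₁ m₂ : ℤ) (s : ℂ) {f : Matrix (l ⊕ l) (l ⊕ l) ℂ → ℂ}
    (hP : IsArchSiegelSection (fun z : ℂ => (conj z / ((‖z‖ : ℝ) : ℂ)) ^ (-(m₁ + m₂))) s f)
    (hK : ∀ g u : Matrix (l ⊕ l) (l ⊕ l) ℂ, gᴴ * Matrix.J l ℂ * g = Matrix.J l ℂ → uᴴ * Matrix.J l ℂ * u = Matrix.J l ℂ →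
      moeb u (I • (1 : Matrix l l ℂ)) = I • 1 →
        f (g * u) = (u.toBlocks₁₁ + I • u.toBlocks₁₂).det ^ m₁ * (u.toBlocks₁₁ - I • u.toBlocks₁₂).det ^ m₂ * f g)
    {g : Matrix (l ⊕ l) (l ⊕ l) ℂ} (hg : gᴴ * Matrix.J l ℂ * g = Matrix.J l ℂ) :
    f g = f 1 * g.det ^ m₁ * archScalarSection (m₁ - m₂) s g := by
  -- the untwisted function
  set G : Matrix (l ⊕ l) (l ⊕ l) ℂ → ℂ := fun g => g.det ^ (-m₁) * f g with hG
  have hGP : IsArchSiegelSection (fun z : ℂ => (conj z / ((‖z‖ : ℝ) : ℂ)) ^ (m₁ - m₂)) s G := by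
    intro p g' hp hp21
    have hz := det_toBlocks₁₁_ne_zero_of_isSiegel hp hp21
    have hw := det_mul_conj_det_eq_of_isSiegel hp hp21
    have hdp : p.det ≠ 0 := det_ne_zero_of_mem_UJ hp
    simp only [hG]
    rw [Matrix.det_mul, mul_zpow, hP p g' hp hp21, show (m₁ - m₂ : ℤ) = -(m₁ + m₂) + 2 * m₁ by ring, ← charTwist_zpow hz hw m₁ (-(m₁ + m₂))]
    ring
  have hGK : ∀ g u : Matrix (l ⊕ l) (l ⊕ l) ℂ, gᴴ * Matrix.J l ℂ * g = Matrix.J l ℂ → uᴴ * Matrix.J l ℂ * u = Matrix.J l ℂ →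
      moeb u (I • (1 : Matrix l l ℂ)) = I • 1 → G (g * u) = (denom u (I • (1 : Matrix l l ℂ))).det ^ (-(m₁ - m₂)) * G g := by
    intro g' u hg' hu huI
    obtain ⟨hc₁, hc₂⟩ := cayley_mem_unitaryGroup hu huI
    have h1 : (u.toBlocks₁₁ + I • u.toBlocks₁₂).det ≠ 0 := (Matrix.isUnit_det_of_left_inverse (Matrix.mem_unitaryGroup_iff'.1 hc₁)).ne_zero
    have h2 : (u.toBlocks₁₁ - I • u.toBlocks₁₂).det ≠ 0 := (Matrix.isUnit_det_of_left_inverse (Matrix.mem_unitaryGroup_iff'.1 hc₂)).ne_zero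
    have hg'd : g'.det ≠ 0 := det_ne_zero_of_mem_UJ hg'
    have h1m : (u.toBlocks₁₁ + I • u.toBlocks₁₂).det ^ m₁ ≠ 0 := zpow_ne_zero _ h1
    have h2m : (u.toBlocks₁₁ - I • u.toBlocks₁₂).det ^ m₁ ≠ 0 := zpow_ne_zero _ h2
    have h2m' : (u.toBlocks₁₁ - I • u.toBlocks₁₂).det ^ m₂ ≠ 0 := zpow_ne_zero _ h2
    have hgm : g'.det ^ m₁ ≠ 0 := zpow_ne_zero _ hg'd
    simp only [hG]
    rw [Matrix.det_mul, mul_zpow, hK g' u hg' hu huI, det_eq_of_stab hu huI, mul_zpow, det_denom_I_of_stab hu huI, neg_sub, zpow_sub₀ h2,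
      _root_.zpow_neg, _root_.zpow_neg, _root_.zpow_neg]
    field_simp
  have hmain := eq_mul_archScalarSection (m₁ - m₂) s hGP hGK hg
  have hG1 : G 1 = f 1 := by simp only [hG, Matrix.det_one, _root_.one_zpow, one_mul]
  have hdg : g.det ≠ 0 := det_ne_zero_of_mem_UJ hg
  have hfG : f g = g.det ^ m₁ * G g := by
    simp only [hG]
    rw [← mul_assoc, ← zpow_add₀ hdg, add_neg_cancel, zpow_zero, one_mul]
  rw [hfG, hmain, hG1]
  ring

/-- **`f(1) ≠ 0 ⇒ f` vanishes NOWHERE on `U(J)`** (for `f` as in `eq_mul_det_zpow_mul_archScalarSection`): the Gaussian anchor is a GENERATOR everywhere, in particular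
`c_σ ≠ 0` at `g = 1` suffices. [cite: Shimura1997, §16.4] -/
theorem ne_zero_of_apply_one_ne_zero (m₁ m₂ : ℤ) (s : ℂ) {f : Matrix (l ⊕ l) (l ⊕ l) ℂ → ℂ}
    (hP : IsArchSiegelSection (fun z : ℂ => (conj z / ((‖z‖ : ℝ) : ℂ)) ^ (-(m₁ + m₂))) s f)
    (hK : ∀ g u : Matrix (l ⊕ l) (l ⊕ l) ℂ, gᴴ * Matrix.J l ℂ * g = Matrix.J l ℂ → uᴴ * Matrix.J l ℂ * u = Matrix.J l ℂ →
      moeb u (I • (1 : Matrix l l ℂ)) = I • 1 →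
        f (g * u) = (u.toBlocks₁₁ + I • u.toBlocks₁₂).det ^ m₁ * (u.toBlocks₁₁ - I • u.toBlocks₁₂).det ^ m₂ * f g)
    (h1 : f 1 ≠ 0) {g : Matrix (l ⊕ l) (l ⊕ l) ℂ} (hg : gᴴ * Matrix.J l ℂ * g = Matrix.J l ℂ) : f g ≠ 0 := by
  rw [eq_mul_det_zpow_mul_archScalarSection m₁ m₂ s hP hK hg, archScalarSection_apply]
  have hdg : g.det ≠ 0 := det_ne_zero_of_mem_UJ hg
  have hdd : (denom g (I • (1 : Matrix l l ℂ))).det ≠ 0 := det_denom_ne_zero hg posDef_im_I_smul_one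
  have hn : (((‖(denom g (I • (1 : Matrix l l ℂ))).det‖ : ℝ) : ℂ)) ≠ 0 := Complex.ofReal_ne_zero.2 (norm_ne_zero_iff.2 hdd)
  exact mul_ne_zero (mul_ne_zero h1 (zpow_ne_zero _ hdg))
    (mul_ne_zero (zpow_ne_zero _ hdd) (fun h => hn ((Complex.cpow_eq_zero_iff _ _).1 h).1))

/-- **THE EXPLICIT GENERATOR HAS THAT `K_w`-TYPE**: `h(g) := det(g)^{m₁} · f⁰_{s, m₁−m₂}(g)` satisfies `h(g u) = det(A_u+iB_u)^{m₁} det(A_u−iB_u)^{m₂} h(g)` on `Stab(i1)`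
(★ `archScalarSection_mul_stab`, `det_eq_of_stab`, `det_denom_I_of_stab`). [cite: Shimura1997, §16.4] -/
theorem det_zpow_mul_archScalarSection_mul_stab (m₁ m₂ : ℤ) (s : ℂ) {g u : Matrix (l ⊕ l) (l ⊕ l) ℂ} (hg : gᴴ * Matrix.J l ℂ * g = Matrix.J l ℂ)
    (hu : uᴴ * Matrix.J l ℂ * u = Matrix.J l ℂ) (huI : moeb u (I • (1 : Matrix l l ℂ)) = I • 1) :
    (g * u).det ^ m₁ * archScalarSection (m₁ - m₂) s (g * u) =
      (u.toBlocks₁₁ + I • u.toBlocks₁₂).det ^ m₁ * (u.toBlocks₁₁ - I • u.toBlocks₁₂).det ^ m₂ * (g.det ^ m₁ * archScalarSection (m₁ - m₂) s g) := by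
  obtain ⟨hc₁, hc₂⟩ := cayley_mem_unitaryGroup hu huI
  have h2 : (u.toBlocks₁₁ - I • u.toBlocks₁₂).det ≠ 0 := (Matrix.isUnit_det_of_left_inverse (Matrix.mem_unitaryGroup_iff'.1 hc₂)).ne_zero
  have h2m : (u.toBlocks₁₁ - I • u.toBlocks₁₂).det ^ m₁ ≠ 0 := zpow_ne_zero _ h2
  rw [Matrix.det_mul, mul_zpow, archScalarSection_mul_stab (m₁ - m₂) s hg hu huI, det_eq_of_stab hu huI, mul_zpow, det_denom_I_of_stab hu huI, neg_sub,
    zpow_sub₀ h2]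
  field_simp

/-- **… AND THAT PARABOLIC LAW**: `h(g) := det(g)^{m₁} · f⁰_{s, m₁−m₂}(g)` is a Siegel section of `I_w(s, χ_{−(m₁+m₂)})` (★ `isArchSiegelSection_archScalarSection` + the
det-twist `charTwist_zpow` read backwards). [cite: Shimura1997, §16.4] -/
theorem isArchSiegelSection_det_zpow_mul_archScalarSection (m₁ m₂ : ℤ) (s : ℂ) :
    IsArchSiegelSection (l := l) (fun z : ℂ => (conj z / ((‖z‖ : ℝ) : ℂ)) ^ (-(m₁ + m₂))) s
      (fun g : Matrix (l ⊕ l) (l ⊕ l) ℂ => g.det ^ m₁ * archScalarSection (m₁ - m₂) s g) := by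
  intro p g hp hp21
  have hz := det_toBlocks₁₁_ne_zero_of_isSiegel hp hp21
  have hw := det_mul_conj_det_eq_of_isSiegel hp hp21
  have hdp : p.det ≠ 0 := det_ne_zero_of_mem_UJ hp
  have hdpm : p.det ^ m₁ ≠ 0 := zpow_ne_zero _ hdp
  have hchar := charTwist_zpow hz hw m₁ (-(m₁ + m₂))
  rw [show (-(m₁ + m₂) + 2 * m₁ : ℤ) = m₁ - m₂ by ring, _root_.zpow_neg] at hchar
  -- `χ_{m₁−m₂}(det A_p) = (det p)^{−m₁} · χ_{−(m₁+m₂)}(det A_p)`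
  dsimp only
  rw [Matrix.det_mul, mul_zpow, isArchSiegelSection_archScalarSection (m₁ - m₂) s p g hp hp21]
  dsimp only
  rw [← hchar]
  field_simp

/-- the explicit generator at `g = 1` equals `1`. [folklore] -/
theorem det_zpow_mul_archScalarSection_one (m₁ m₂ : ℤ) (s : ℂ) :
    (1 : Matrix (l ⊕ l) (l ⊕ l) ℂ).det ^ m₁ * archScalarSection (m₁ - m₂) s (1 : Matrix (l ⊕ l) (l ⊕ l) ℂ) = 1 := by
  rw [Matrix.det_one, _root_.one_zpow, one_mul, archScalarSection_one]

end Summit.HodgeConjecture.HodgeConjecture.Cruxes.HLiu418.K2LiuArchGaussianKType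

end
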